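import Mathlib
import HarnessLib
import Summits.NavierStokesRegularity.NavierStokesRegularity.Theorems.PoloidalWindowDoorPoloidalWindowRigidityZShockPSystemLiouville

/-!
# Crux K2 `PoloidalWindowRigidity` (stmt-NavierStokesRegularity-19708), line `z_shock` — RUNG R2, the other sign of `G''`

`--supports stmt-NavierStokesRegularity-19708 --as helper` (leafhand-ns-poloidalwindowdoor-1 g0, 2026-08-30).  Class-free,
Mathlib only.  **No stub and no summit is closed by this file; Navier–Stokes regularity is NOT proved here.**

`…ZShockPSystemLiouville.pSystem_const` proves the two-sided Liouville theorem for the autonomous p-system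
`p_z = −κ(w)² w_x`, `w_z = −p_x` under genuine nonlinearity of the sign `κ' ≥ k₀ > 0`.  The card's hypothesis is `|G''| ≥ c`
(one sign by continuity); the sign `κ' ≤ −k₀ < 0` follows from the first by the symmetry `(w, p, κ) ↦ (−w, −p, κ(−·))`, which maps
solutions to solutions and reverses the sign of `κ'` (`pSystem_const_of_le_neg`).  Together: `pSystem_const_of_sign`. [folklore]
-/

noncomputable section

namespace Summit.NavierStokesRegularity.NavierStokesRegularity.Theorems.PoloidalWindowDoorPoloidalWindowRigidityZShockPSystemLiouvilleNeg

-- the problem directory repeats the summit name (`NavierStokesRegularity/NavierStokesRegularity`)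
set_option linter.dupNamespace false

open Set Filter Topology Function
open Summit.NavierStokesRegularity.NavierStokesRegularity.Theorems.PoloidalWindowDoorPoloidalWindowRigidityZShockPSystemLiouville

/-- **R2, sign `κ' ≤ −k₀ < 0`.**  A two-sided eternal `C²` solution of the autonomous p-system `p_z = −κ(w)² w_x`, `w_z = −p_x` on
`ℝ × ℝ` with `w_x` bounded, `0 < κ_lo ≤ κ ≤ κ_hi`, `|κ'| ≤ k₁` and `κ' ≤ −k₀ < 0` is a constant state (reflect `(w,p,κ) ↦
(−w,−p,κ(−·))` and apply `pSystem_const`). [folklore] -/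
theorem pSystem_const_of_le_neg {w p : ℝ × ℝ → ℝ} {κ κ' K : ℝ → ℝ} (hw : ContDiff ℝ 2 w) (hp : ContDiff ℝ 2 p)
    (hK2 : ContDiff ℝ 2 K) (hKd : ∀ v, HasDerivAt K (κ v) v) (hκd : ∀ v, HasDerivAt κ (κ' v) v)
    (hsys1 : ∀ q, fderiv ℝ p q (1, 0) = -(κ (w q) ^ 2 * fderiv ℝ w q (0, 1)))
    (hsys2 : ∀ q, fderiv ℝ w q (1, 0) = -fderiv ℝ p q (0, 1))
    {κlo κhi k₀ k₁ W₁ : ℝ} (hκlo0 : 0 < κlo) (hκlo : ∀ v, κlo ≤ κ v) (hκhi : ∀ v, κ v ≤ κhi)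
    (hk₀ : 0 < k₀) (hgnl : ∀ v, κ' v ≤ -k₀) (hk₁ : ∀ v, |κ' v| ≤ k₁) (hW₁ : ∀ q, |fderiv ℝ w q (0, 1)| ≤ W₁) :
    ∀ q q' : ℝ × ℝ, w q = w q' ∧ p q = p q' := by
  -- the reflected data
  have hwn : ContDiff ℝ 2 (fun q => -w q) := hw.neg
  have hpn : ContDiff ℝ 2 (fun q => -p q) := hp.neg
  have hKn2 : ContDiff ℝ 2 (fun v => -K (-v)) := (hK2.comp contDiff_neg).neg
  have hKnd : ∀ v, HasDerivAt (fun v => -K (-v)) (κ (-v)) v := by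
    intro v
    have h := ((hKd (-v)).comp v (hasDerivAt_neg v)).neg
    exact h.congr_deriv (by ring)
  have hκnd : ∀ v, HasDerivAt (fun v => κ (-v)) (-κ' (-v)) v := by
    intro v
    have h := (hκd (-v)).comp v (hasDerivAt_neg v)
    exact h.congr_deriv (by ring)
  have hfw : ∀ q v, fderiv ℝ (fun q => -w q) q v = -fderiv ℝ w q v := fun q v => by
    rw [show (fun q => -w q) = -w from rfl, fderiv_neg]; rfl
  have hfp : ∀ q v, fderiv ℝ (fun q => -p q) q v = -fderiv ℝ p q v := fun q v => by
    rw [show (fun q => -p q) = -p from rfl, fderiv_neg]; rfl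
  have hsys1' : ∀ q, fderiv ℝ (fun q => -p q) q (1, 0) =
      -((κ (-(-w q))) ^ 2 * fderiv ℝ (fun q => -w q) q (0, 1)) := by
    intro q; rw [hfp, hfw, hsys1, neg_neg]; ring
  have hsys2' : ∀ q, fderiv ℝ (fun q => -w q) q (1, 0) = -fderiv ℝ (fun q => -p q) q (0, 1) := by
    intro q; rw [hfw, hfp, hsys2]
  have hgnl' : ∀ v, k₀ ≤ -κ' (-v) := fun v => by linarith [hgnl (-v)]
  have hk₁' : ∀ v, |-κ' (-v)| ≤ k₁ := fun v => by rw [abs_neg]; exact hk₁ (-v)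
  have hW₁' : ∀ q, |fderiv ℝ (fun q => -w q) q (0, 1)| ≤ W₁ := fun q => by rw [hfw, abs_neg]; exact hW₁ q
  have h := pSystem_const (κ := fun v => κ (-v)) (κ' := fun v => -κ' (-v)) (K := fun v => -K (-v)) hwn hpn hKn2 hKnd hκnd
    hsys1' hsys2' hκlo0 (fun v => hκlo (-v)) (fun v => hκhi (-v)) hk₀ hgnl' hk₁' hW₁'
  intro q q'
  obtain ⟨h1, h2⟩ := h q q'
  exact ⟨by linarith, by linarith⟩

/-- **R2, either sign** (`|κ'| ≥ k₀` with a fixed sign, as in the card's `|G''| ≥ c`). [folklore] -/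
theorem pSystem_const_of_sign {w p : ℝ × ℝ → ℝ} {κ κ' K : ℝ → ℝ} (hw : ContDiff ℝ 2 w) (hp : ContDiff ℝ 2 p)
    (hK2 : ContDiff ℝ 2 K) (hKd : ∀ v, HasDerivAt K (κ v) v) (hκd : ∀ v, HasDerivAt κ (κ' v) v)
    (hsys1 : ∀ q, fderiv ℝ p q (1, 0) = -(κ (w q) ^ 2 * fderiv ℝ w q (0, 1)))
    (hsys2 : ∀ q, fderiv ℝ w q (1, 0) = -fderiv ℝ p q (0, 1))
    {κlo κhi k₀ k₁ W₁ : ℝ} (hκlo0 : 0 < κlo) (hκlo : ∀ v, κlo ≤ κ v) (hκhi : ∀ v, κ v ≤ κhi)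
    (hk₀ : 0 < k₀) (hgnl : (∀ v, k₀ ≤ κ' v) ∨ (∀ v, κ' v ≤ -k₀)) (hk₁ : ∀ v, |κ' v| ≤ k₁)
    (hW₁ : ∀ q, |fderiv ℝ w q (0, 1)| ≤ W₁) :
    ∀ q q' : ℝ × ℝ, w q = w q' ∧ p q = p q' := by
  rcases hgnl with h | h
  · exact pSystem_const hw hp hK2 hKd hκd hsys1 hsys2 hκlo0 hκlo hκhi hk₀ h hk₁ hW₁
  · exact pSystem_const_of_le_neg hw hp hK2 hKd hκd hsys1 hsys2 hκlo0 hκlo hκhi hk₀ h hk₁ hW₁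

end Summit.NavierStokesRegularity.NavierStokesRegularity.Theorems.PoloidalWindowDoorPoloidalWindowRigidityZShockPSystemLiouvilleNeg

end
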